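import Mathlib
import HarnessLib

/-!
# Crux `EulerZoomLiouville.PowerGaugeEulerLiouville` (stmt-NavierStokesRegularity-19832), sub-line `casimir_haul` (H3 `stub_haulingInequality`):
# THE LOGARITHMIC MOMENT BOOKKEEPING IN THE AXIAL VARIABLE (pure real analysis)

Route №10 `EulerZoomLiouville` (NavierStokesRegularity), crux E = stmt-NavierStokesRegularity-19832; width seat ns-ezl-w2 g7 under the LEAD ns-typeII-p2.
H3 turns the planar log-Poincaré inequality for small sets (`Literature…logPoincare_smallSets`, H2) into the HAULING INEQUALITY by
slicing the solid cylinder `{r < 2b, |x₃| < b}` along `x₃ = z`: with `a_z = |A_z|` (slice area, `≤ 4πb²`), `m_z = ∫_{A_z} r²` (slice moment,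
`a_z² ≤ 2π m_z` by the planar bathtub `Literature…sq_volume_le_lintegral_norm_sq`) and `M_A = ∫ m_z dz`, Cauchy–Schwarz in `z` leaves the
one-dimensional quantity `∫_{(−b,b)} a_z² (1 + log(4πb²/a_z)) dz`, which this file bounds by `C·M_A (1 + log b + log⁺(b/M_A))` WITHOUT Jensen:

* `sq_mul_one_add_log_le` — pointwise: `0 ≤ a ≤ Y`, `a² ≤ K m` ⇒ `a²(1 + log(Y/a)) ≤ K m (1 + ½ log⁺(Y²/(K m)))`
  (monotonicity of `y ↦ y²(1 + log(Y/y))` on `[0, Y]`, `monotoneOn_sq_mul_one_add_log`);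
* `mul_posLog_div_le` — `m log⁺(c/m) ≤ m log⁺(c/M₀) + M₀` (`log⁺(xy) ≤ log⁺x + log⁺y`, `m log(M₀/m) ≤ M₀`);
* `integral_sq_mul_log_le` — THE BOOKKEEPING: `∫_{(−b,b)} a²(1 + log(4πb²/a)) ≤ 2π M (3/2 + ½ log⁺(16π b⁵/M))`
  for `b ≥ 1`, `0 ≤ a ≤ 4πb²`, `0 ≤ m`, `a² ≤ 2π m` on `(−b,b)`, `m` integrable with `∫ m = M > 0`;
* `integral_sq_mul_log_le'` — the same with the line's capacity factor: `≤ 32 M (1 + log b + log⁺(b/M))`.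
[folklore: elementary calculus]

WHAT THIS IS NOT: not NS, not E, not H3 — real-analysis plumbing `--supports` stmt-19832; 19832 is OPEN.
-/

noncomputable section

-- flat `Theorems/<Route><Decl>…` files of one crux share the namespace of the crux (tree convention)
set_option linter.dupNamespace false

open MeasureTheory Set Filter Real
open scoped Topology

namespace Summit.NavierStokesRegularity.NavierStokesRegularity.Theorems.PowerGaugeEulerLiouville.CasimirHaul

section Pointwise

/-- `y ↦ y²(1 + log(Y/y))` is monotone on `[0, Y]` (derivative `y(1 + 2log(Y/y)) ≥ 0`). [folklore] -/
theorem monotoneOn_sq_mul_one_add_log {Y : ℝ} (hY : 0 < Y) :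
    MonotoneOn (fun y : ℝ => y ^ 2 * (1 + Real.log (Y / y))) (Icc 0 Y) := by
  -- rewrite as `y²(1 + log Y) − y² log y` to use continuity of `y log y` at `0`
  have hcont : ContinuousOn (fun y : ℝ => y ^ 2 * (1 + Real.log (Y / y))) (Icc 0 Y) := by
    have e : ∀ y ∈ Icc (0 : ℝ) Y, y ^ 2 * (1 + Real.log (Y / y)) = y ^ 2 * (1 + Real.log Y) - y * (y * Real.log y) := by
      intro y hy
      rcases eq_or_lt_of_le hy.1 with h0 | h0
      · rw [← h0]; simp
      · rw [Real.log_div hY.ne' h0.ne']; ring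
    refine ContinuousOn.congr ?_ e
    exact ((continuous_id.pow 2).mul continuous_const).continuousOn.sub
      ((continuous_id.mul Real.continuous_mul_log).continuousOn)
  have hderiv : ∀ y ∈ interior (Icc (0 : ℝ) Y), HasDerivAt (fun y : ℝ => y ^ 2 * (1 + Real.log (Y / y)))
      (y * (1 + 2 * Real.log (Y / y))) y := by
    intro y hy
    rw [interior_Icc] at hy
    have hy0 : y ≠ 0 := hy.1.ne'
    have h1 : HasDerivAt (fun y : ℝ => Real.log (Y / y)) (-y⁻¹) y := by
      have h : HasDerivAt (fun y : ℝ => Real.log Y - Real.log y) (0 - y⁻¹) y :=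
        (hasDerivAt_const y (Real.log Y)).sub (Real.hasDerivAt_log hy0)
      rw [zero_sub] at h
      refine h.congr_of_eventuallyEq ?_
      filter_upwards [lt_mem_nhds hy.1] with y' hy'
      exact Real.log_div hY.ne' hy'.ne'
    have h2 : HasDerivAt (fun y : ℝ => y * y) (1 * y + y * 1) y := (hasDerivAt_id y).mul (hasDerivAt_id y)
    have h3 : HasDerivAt (fun y : ℝ => y * y * (1 + Real.log (Y / y)))
        ((1 * y + y * 1) * (1 + Real.log (Y / y)) + y * y * (0 + -y⁻¹)) y :=
      h2.mul ((hasDerivAt_const y (1 : ℝ)).add h1)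
    have e : (fun y : ℝ => y ^ 2 * (1 + Real.log (Y / y))) = fun y => y * y * (1 + Real.log (Y / y)) := by
      funext y; ring
    rw [e]
    refine h3.congr_deriv ?_
    field_simp
    ring
  refine monotoneOn_of_deriv_nonneg (convex_Icc 0 Y) hcont ?_ ?_
  · intro y hy
    exact (hderiv y hy).differentiableAt.differentiableWithinAt
  · intro y hy
    rw [(hderiv y hy).deriv]
    rw [interior_Icc] at hy
    have hlog : 0 ≤ Real.log (Y / y) := Real.log_nonneg ((one_le_div hy.1).2 hy.2.le)
    have : 0 ≤ y := hy.1.le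
    positivity

/-- **Pointwise**: `0 ≤ a ≤ Y`, `0 ≤ m`, `a² ≤ K m` (`K > 0`) ⇒ `a²(1 + log(Y/a)) ≤ K m (1 + ½ log⁺(Y²/(K m)))`. [folklore] -/
theorem sq_mul_one_add_log_le {a m K Y : ℝ} (hK : 0 < K) (hY : 0 < Y) (ha0 : 0 ≤ a) (haY : a ≤ Y) (hm : 0 ≤ m)
    (ham : a ^ 2 ≤ K * m) :
    a ^ 2 * (1 + Real.log (Y / a)) ≤ K * m * (1 + Real.posLog (Y ^ 2 / (K * m)) / 2) := by
  have hmono := monotoneOn_sq_mul_one_add_log hY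
  rcases eq_or_lt_of_le hm with hm0 | hm0
  · -- `m = 0` forces `a = 0`
    have ha : a = 0 := by nlinarith
    subst ha; rw [← hm0]; simp
  have hKm : 0 < K * m := mul_pos hK hm0
  have hpos : 0 ≤ Real.posLog (Y ^ 2 / (K * m)) := Real.posLog_nonneg
  have ha_le : a ≤ Real.sqrt (K * m) := by
    have h := Real.abs_le_sqrt ham
    rwa [abs_of_nonneg ha0] at h
  by_cases hcase : Real.sqrt (K * m) ≤ Y
  · -- monotonicity up to `√(Km) ≤ Y`, then `log(Y/√(Km)) = ½ log(Y²/(Km)) = ½ log⁺(Y²/(Km))`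
    have h1 := hmono ⟨ha0, haY⟩ ⟨Real.sqrt_nonneg _, hcase⟩ ha_le
    simp only at h1
    refine h1.trans (le_of_eq ?_)
    rw [Real.sq_sqrt hKm.le]
    have hge1 : 1 ≤ Y ^ 2 / (K * m) := by
      rw [one_le_div hKm]
      calc K * m = Real.sqrt (K * m) ^ 2 := (Real.sq_sqrt hKm.le).symm
        _ ≤ Y ^ 2 := pow_le_pow_left₀ (Real.sqrt_nonneg _) hcase 2
    rw [Real.posLog_eq_log (by rw [abs_of_pos (by positivity)]; exact hge1)]
    have e : Real.log (Y / Real.sqrt (K * m)) = Real.log (Y ^ 2 / (K * m)) / 2 := by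
      rw [Real.log_div hY.ne' (Real.sqrt_pos.2 hKm).ne', Real.log_sqrt hKm.le, Real.log_div (by positivity) hKm.ne',
        Real.log_pow]
      push_cast
      ring
    rw [e]
  · -- `√(Km) > Y`: `g(a) ≤ g(Y) = Y² < Km`
    rw [not_le] at hcase
    have h1 := hmono ⟨ha0, haY⟩ ⟨hY.le, le_rfl⟩ haY
    simp only [div_self hY.ne', Real.log_one, add_zero, mul_one] at h1
    have hY2 : Y ^ 2 < K * m := by
      calc Y ^ 2 < Real.sqrt (K * m) ^ 2 := pow_lt_pow_left₀ hcase hY.le two_ne_zero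
        _ = K * m := Real.sq_sqrt hKm.le
    calc a ^ 2 * (1 + Real.log (Y / a)) ≤ Y ^ 2 := h1
      _ ≤ K * m := hY2.le
      _ ≤ K * m * (1 + Real.posLog (Y ^ 2 / (K * m)) / 2) := by
          have : 1 ≤ 1 + Real.posLog (Y ^ 2 / (K * m)) / 2 := by linarith
          exact le_mul_of_one_le_right hKm.le this

/-- `m log⁺(c/m) ≤ m log⁺(c/M₀) + M₀` for `m ≥ 0`, `M₀ > 0`. [folklore] -/
theorem mul_posLog_div_le {m M₀ c : ℝ} (hm : 0 ≤ m) (hM : 0 < M₀) :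
    m * Real.posLog (c / m) ≤ m * Real.posLog (c / M₀) + M₀ := by
  rcases eq_or_lt_of_le hm with hm0 | hm0
  · rw [← hm0]; simp [hM.le]
  have hsplit : Real.posLog (c / m) ≤ Real.posLog (c / M₀) + Real.posLog (M₀ / m) := by
    have e : c / m = (c / M₀) * (M₀ / m) := by field_simp
    rw [e]; exact Real.posLog_mul
  -- `m log⁺(M₀/m) ≤ M₀`
  have hml : m * Real.posLog (M₀ / m) ≤ M₀ := by
    by_cases h : M₀ ≤ m
    · have : Real.posLog (M₀ / m) = 0 := by
        rw [Real.posLog_eq_zero_iff, abs_of_pos (by positivity)]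
        exact (div_le_one hm0).2 h
      rw [this, mul_zero]; exact hM.le
    · rw [not_le] at h
      have hge : 1 ≤ M₀ / m := (one_le_div hm0).2 h.le
      rw [Real.posLog_eq_log (by rw [abs_of_pos (by positivity)]; exact hge)]
      have hl := Real.log_le_sub_one_of_pos (show 0 < M₀ / m by positivity)
      calc m * Real.log (M₀ / m) ≤ m * (M₀ / m - 1) := mul_le_mul_of_nonneg_left hl hm
        _ = M₀ - m := by field_simp
        _ ≤ M₀ := by linarith
  calc m * Real.posLog (c / m) ≤ m * (Real.posLog (c / M₀) + Real.posLog (M₀ / m)) := mul_le_mul_of_nonneg_left hsplit hm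
    _ = m * Real.posLog (c / M₀) + m * Real.posLog (M₀ / m) := by ring
    _ ≤ m * Real.posLog (c / M₀) + M₀ := by linarith

end Pointwise

section Integrated

/-- **THE LOGARITHMIC MOMENT BOOKKEEPING**: for `b ≥ 1` and functions `a, m` on `(−b, b)` with `0 ≤ a ≤ 4πb²`, `0 ≤ m`,
`a² ≤ 2π m` (slice area vs. slice moment, planar bathtub) and `m` integrable with `M = ∫ m > 0`:
`∫_{(−b,b)} a²(1 + log(4πb²/a)) ≤ 2π M (3/2 + ½ log⁺(16π b⁵/M))`. [folklore] -/
theorem integral_sq_mul_log_le {b : ℝ} (hb : 1 ≤ b) {a m : ℝ → ℝ}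
    (ha0 : ∀ z ∈ Ioo (-b) b, 0 ≤ a z) (haY : ∀ z ∈ Ioo (-b) b, a z ≤ 4 * π * b ^ 2)
    (hm0 : ∀ z ∈ Ioo (-b) b, 0 ≤ m z) (ham : ∀ z ∈ Ioo (-b) b, a z ^ 2 ≤ 2 * π * m z)
    (hmi : IntegrableOn m (Ioo (-b) b)) (hM : 0 < ∫ z in Ioo (-b) b, m z) :
    ∫ z in Ioo (-b) b, a z ^ 2 * (1 + Real.log (4 * π * b ^ 2 / a z)) ≤
      2 * π * (∫ z in Ioo (-b) b, m z) * (3 / 2 + Real.posLog (16 * π * b ^ 5 / ∫ z in Ioo (-b) b, m z) / 2) := by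
  set M : ℝ := ∫ z in Ioo (-b) b, m z with hMdef
  have hb0 : 0 < b := by linarith
  set Y : ℝ := 4 * π * b ^ 2 with hYdef
  have hY : 0 < Y := by positivity
  set M₀ : ℝ := M / (2 * b) with hM₀def
  have hM₀ : 0 < M₀ := by positivity
  set c : ℝ := Y ^ 2 / (2 * π) with hcdef
  -- the integrable majorant
  obtain ⟨g, hgdef⟩ : ∃ g : ℝ → ℝ, g = fun z => 2 * π * m z + π * (m z * Real.posLog (c / M₀) + M₀) := ⟨_, rfl⟩
  haveI : IsFiniteMeasure (volume.restrict (Ioo (-b) b)) := by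
    refine isFiniteMeasure_restrict.2 ?_
    rw [Real.volume_Ioo]; exact ENNReal.ofReal_ne_top
  have hci : IntegrableOn (fun _ : ℝ => M₀) (Ioo (-b) b) :=
    integrableOn_const (by rw [Real.volume_Ioo]; exact ENNReal.ofReal_ne_top)
  have hgi : IntegrableOn g (Ioo (-b) b) := by
    rw [hgdef]
    exact (hmi.const_mul _).add (((hmi.mul_const _).add hci).const_mul _)
  -- pointwise: `a²(1+log(Y/a)) ≤ 2π m (1 + ½ log⁺(c/m)) ≤ g`
  have hfg : ∀ z ∈ Ioo (-b) b, a z ^ 2 * (1 + Real.log (4 * π * b ^ 2 / a z)) ≤ g z := by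
    intro z hz
    have h1 := sq_mul_one_add_log_le Real.two_pi_pos hY (ha0 z hz) (haY z hz) (hm0 z hz) (ham z hz)
    have h2 := mul_posLog_div_le (c := c) (hm0 z hz) hM₀
    have ec : Y ^ 2 / (2 * π * m z) = c / m z := by rw [hcdef, div_div]
    rw [ec] at h1
    rw [hgdef]
    dsimp only
    calc a z ^ 2 * (1 + Real.log (Y / a z)) ≤ 2 * π * m z * (1 + Real.posLog (c / m z) / 2) := h1
      _ = 2 * π * m z + π * (m z * Real.posLog (c / m z)) := by ring
      _ ≤ 2 * π * m z + π * (m z * Real.posLog (c / M₀) + M₀) := by gcongr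
  have hf0 : ∀ z ∈ Ioo (-b) b, 0 ≤ a z ^ 2 * (1 + Real.log (4 * π * b ^ 2 / a z)) := by
    intro z hz
    rcases eq_or_lt_of_le (ha0 z hz) with h0 | h0
    · rw [← h0]; simp
    · have : 0 ≤ Real.log (4 * π * b ^ 2 / a z) := Real.log_nonneg ((one_le_div h0).2 (haY z hz))
      positivity
  -- integrate (`f` need not be integrable: `integral_mono_of_nonneg`)
  have hint : ∫ z in Ioo (-b) b, a z ^ 2 * (1 + Real.log (4 * π * b ^ 2 / a z)) ≤ ∫ z in Ioo (-b) b, g z :=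
    integral_mono_of_nonneg ((ae_restrict_iff' measurableSet_Ioo).2 (Eventually.of_forall hf0)) hgi
      ((ae_restrict_iff' measurableSet_Ioo).2 (Eventually.of_forall hfg))
  refine hint.trans (le_of_eq ?_)
  -- evaluate `∫ g`
  have hvol : (volume : Measure ℝ).real (Ioo (-b) b) = 2 * b := by
    rw [measureReal_def, Real.volume_Ioo, ENNReal.toReal_ofReal (by linarith)]; ring
  rw [hgdef]
  dsimp only
  have i1 : IntegrableOn (fun z => 2 * π * m z) (Ioo (-b) b) := hmi.const_mul _
  have i2 : IntegrableOn (fun z => m z * Real.posLog (c / M₀)) (Ioo (-b) b) := hmi.mul_const _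
  have i3 : IntegrableOn (fun z => m z * Real.posLog (c / M₀) + M₀) (Ioo (-b) b) := i2.add hci
  have i4 : IntegrableOn (fun z => π * (m z * Real.posLog (c / M₀) + M₀)) (Ioo (-b) b) := i3.const_mul _
  rw [integral_add i1 i4, integral_const_mul, integral_const_mul, integral_add i2 hci,
    integral_mul_const, setIntegral_const, hvol, smul_eq_mul]
  -- `M₀ · 2b = M`, `c/M₀ = 16π b⁵ / M`
  have e1 : 2 * b * M₀ = M := by rw [hM₀def]; field_simp
  have e2 : c / M₀ = 16 * π * b ^ 5 / M := by
    rw [hcdef, hM₀def, hYdef]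
    field_simp
    ring
  rw [e1, e2]
  ring

/-- `log(16π) ≤ 4` (since `16π < 50.3 < e⁴`). [folklore] -/
theorem log_sixteen_pi_le : Real.log (16 * π) ≤ 4 := by
  rw [Real.log_le_iff_le_exp (by positivity)]
  have he : (2.7182818283 : ℝ) < Real.exp 1 := Real.exp_one_gt_d9
  have h4 : Real.exp 4 = Real.exp 1 ^ 4 := by
    rw [← Real.exp_nat_mul]; norm_num
  have hp : (2.7182818283 : ℝ) ^ 4 < Real.exp 1 ^ 4 := pow_lt_pow_left₀ he (by norm_num) four_ne_zero
  nlinarith [Real.pi_lt_d4, hp, h4]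

/-- **THE BOOKKEEPING IN THE LINE'S CURRENCY**: same hypotheses ⇒
`∫_{(−b,b)} a²(1 + log(4πb²/a)) ≤ 32 · M · (1 + log b + max 0 (log(b/M)))`. [folklore] -/
theorem integral_sq_mul_log_le' {b : ℝ} (hb : 1 ≤ b) {a m : ℝ → ℝ}
    (ha0 : ∀ z ∈ Ioo (-b) b, 0 ≤ a z) (haY : ∀ z ∈ Ioo (-b) b, a z ≤ 4 * π * b ^ 2)
    (hm0 : ∀ z ∈ Ioo (-b) b, 0 ≤ m z) (ham : ∀ z ∈ Ioo (-b) b, a z ^ 2 ≤ 2 * π * m z)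
    (hmi : IntegrableOn m (Ioo (-b) b)) (hM : 0 < ∫ z in Ioo (-b) b, m z) :
    ∫ z in Ioo (-b) b, a z ^ 2 * (1 + Real.log (4 * π * b ^ 2 / a z)) ≤
      32 * (∫ z in Ioo (-b) b, m z) * (1 + Real.log b + max 0 (Real.log (b / ∫ z in Ioo (-b) b, m z))) := by
  set M : ℝ := ∫ z in Ioo (-b) b, m z with hMdef
  have h := integral_sq_mul_log_le hb ha0 haY hm0 ham hmi hM
  refine h.trans ?_
  have hb0 : 0 < b := by linarith
  -- `log⁺(16π b⁵/M) ≤ log(16π) + 4 log b + log⁺(b/M)`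
  have hsplit : Real.posLog (16 * π * b ^ 5 / M) ≤ 4 + 4 * Real.log b + max 0 (Real.log (b / M)) := by
    have e : 16 * π * b ^ 5 / M = (16 * π * b ^ 4) * (b / M) := by field_simp
    rw [e]
    refine Real.posLog_mul.trans ?_
    have h1 : Real.posLog (16 * π * b ^ 4) = Real.log (16 * π) + 4 * Real.log b := by
      have hge : 1 ≤ 16 * π * b ^ 4 := by
        have : 1 ≤ b ^ 4 := one_le_pow₀ hb
        nlinarith [Real.pi_gt_three]
      rw [Real.posLog_eq_log (by rw [abs_of_pos (by positivity)]; exact hge), Real.log_mul (by positivity) (by positivity),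
        Real.log_pow]
      push_cast
      ring_nf
    have h2 : Real.posLog (b / M) = max 0 (Real.log (b / M)) := rfl
    rw [h1, h2]
    linarith [log_sixteen_pi_le]
  have hpos : 0 ≤ max 0 (Real.log (b / M)) := le_max_left _ _
  have hlogb : 0 ≤ Real.log b := Real.log_nonneg hb
  have hπ : π < 3.1416 := Real.pi_lt_d4
  have h1 : 3 / 2 + Real.posLog (16 * π * b ^ 5 / M) / 2 ≤ 7 / 2 * (1 + Real.log b + max 0 (Real.log (b / M))) := by
    linarith
  have hX : 0 ≤ M * (1 + Real.log b + max 0 (Real.log (b / M))) := by positivity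
  calc 2 * π * M * (3 / 2 + Real.posLog (16 * π * b ^ 5 / M) / 2)
      ≤ 2 * π * M * (7 / 2 * (1 + Real.log b + max 0 (Real.log (b / M)))) := by gcongr
    _ = 7 * π * (M * (1 + Real.log b + max 0 (Real.log (b / M)))) := by ring
    _ ≤ 32 * (M * (1 + Real.log b + max 0 (Real.log (b / M)))) := by nlinarith
    _ = 32 * M * (1 + Real.log b + max 0 (Real.log (b / M))) := by ring

end Integrated

end Summit.NavierStokesRegularity.NavierStokesRegularity.Theorems.PowerGaugeEulerLiouville.CasimirHaul

end
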